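import Mathlib
import Summits.BirchSwinnertonDyer.BirchSwinnertonDyer.Theorems.ResidualThetaTransportAtTwoResidualSignedLambdaLowerCMAtTwoColemanSidePush
import HarnessLib

/-!
# The (i)-half PRICE node of S3″, decomposed with PROVED glue: SCHUR ⟹ MATRIX (the `𝒪`-action through `Θ` is a ring hom `A : 𝒪 →+* Mₙ(ℤ₂)`),
# the coefficientwise TRIVIALISATION `e : Λⁿ ≃+ Λ_𝒪` (H10 from LIN-X + LIN-𝒪 + LATTICE), the column identity `he` (H10 + H11), LATTICE, and `n = f`

Route `ResidualThetaTransportAtTwo` (RTT), crux RSL_g `ResidualSignedLambdaLowerCMAtTwo` (stmt-BirchSwinnertonDyer-22608), hold KZ_g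
`KatoZetaCMFormAtTwoSupply` (stmt-BirchSwinnertonDyer-24105). Width seat `prover-bsd-wall-tp2-p2x-w2` g21 (`--supports 22608 --as helper`, closes
nothing). THEOREMS ONLY (no `def`, no instance, no notation, no named fact, no `sorry`); generic algebra (`R`, `𝒪`, `T`, `M`, `H` abstract); BSD is NOT
proved by any of this; 22608 / 26074 / 24105 stay OPEN / HOLD. PORT of the kernel-checked sketch
`Cruxes/ResidualThetaCountLowerPureAtTwo/Sketch_sidea_k3_g19.lean` (stub-ideation k3 g19; STUB-PLAN rev 26 row 74 «DECOMPOSITION OF RECORD of the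
S109 PRICE node», S120), statements and proofs VERBATIM up to (a) the namespace and (b) the sketch's four auxiliary `def`s (`conjAct`, `triv`, `actHom`,
`twoTorsionEquiv`) being INLINED: the trivialisation is produced by `exists_coeffwise_addEquiv` and its properties are stated for ANY `e` with the
coefficientwise formula (`he : ∀ t m, coeff m (e t) = Φ⁻¹ ((coeff m (t i))_i)`). Credit: stub-ideation k3 g19 (every statement), k2 g18 / k2 g19 (H10/H11
cut, LATTICE), k4 g20 (H8/H9 typing). A `Theorems/` file cannot import the sketch; the (i)-half of the KZ_g glue `katoZetaCMAtTwo_of_facts` imports this.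

DICTIONARY (RTT): `R := ℤ_[2]`, `𝒪 := padicCoeffIntegers S`, `ι := padicIntToCoeffIntegers S`, `Λ := PowerSeries ℤ_[2]`, `Λ_𝒪 := PowerSeries 𝒪`, `H := I.H`,
`𝒸 := π.cvec`, `S := Submodule.span Λ_𝒪 {z}`, `T := ↥(W.geomPrimaryTorsion 2)`, `M := Cofree ρ F`, `Θ := Θ π.v π.hv : M ≃+ (Fin n → T)`.
§1 SCHUR ⟹ MATRIX: `exists_matrix_of_equivariant`, `matrix_eq_of_faithful`, `exists_ringHom_of_equivariant` (`Θ (a • m) i = ∑ j, A a i j • Θ m j`).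
§2 TRIVIALISATION: `exists_coeffwise_addEquiv`, `coeffwise_smul` (`Λ`-semilinear), `coeffwise_X_smul`, `coeffwise_matrixSMul`.
§3 H10 FROM ITS PARTS: `semilinear_on_submodule`, `exists_trivialisation` (LIN-X + LIN-𝒪 on `S` + LATTICE ⟹ `e (𝒸 (s • x)) = s * e (𝒸 x)`, by the landed
   `ColemanSideInjective.apply_smul_eq_smul_of_X_of_C` run with `A := 𝒪`, `V := Λ_𝒪`). §4 GLUE: `he_of_parts`, `price_of_parts` (`⟨e, u, hu, he⟩`).
§5 LATTICE: `exists_equivariant_addEquiv`, `htf_of_norm`. §6 `n_eq_of_card_two_torsion` (`n = f` from `2`-torsion cardinalities).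

References: [Washington1997] §13.2, §7.1; [Lang1990] Ch. 5 §1; [Kato2004Asterisque] Thm. 12.5 (1), §13.8; [Kobayashi2003] Thm. 6.2; [Serre1972] Prop. 12.
-/

set_option autoImplicit false
-- the Theorems namespace of this sub repeats the summit name by design (D-0017 nested layout)
set_option linter.dupNamespace false

noncomputable section

namespace Summit.BirchSwinnertonDyer.BirchSwinnertonDyer.Theorems.ThetaTransport.PriceNode

/-! ## §1 SCHUR ⟹ MATRIX: equivariant endomorphisms of `Tⁿ`, and the ring hom `A : 𝒪 →+* Mₙ(R)` transported through `Θ` -/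

section SchurMatrix

variable {R : Type*} [CommRing R] {T : Type*} [AddCommGroup T] [Module R T]
  {G : Type*} [Monoid G] [DistribMulAction G T]

/-- `∑ j, A i j • ∑ l, B j l • w l = ∑ l, (A * B) i l • w l` (module-valued `mulVec_mulVec`). [cite: Lang1990, Ch. 5 §1] -/
theorem sum_smul_sum_smul {n : ℕ} (A B : Matrix (Fin n) (Fin n) R) (w : Fin n → T) (i : Fin n) :
    ∑ j, A i j • ∑ l, B j l • w l = ∑ l, (A * B) i l • w l := by
  simp_rw [Finset.smul_sum, ← mul_smul, Matrix.mul_apply, Finset.sum_smul]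
  rw [Finset.sum_comm]

/-- **Schur ⟹ matrix.** If every `G`-equivariant additive endomorphism of `T` is an `R`-scalar, then every `G`-equivariant additive endomorphism of `Tⁿ`
(diagonal action) is an `R`-matrix: `F w i = ∑ j, A i j • w j`. [cite: Serre1972, Prop. 12] [cite: Lang1990, Ch. 5 §1] -/
theorem exists_matrix_of_equivariant {n : ℕ} (D : Set G)
    (hSchur : ∀ f : T →+ T, (∀ g ∈ D, ∀ t : T, f (g • t) = g • f t) → ∃ c : R, ∀ t, f t = c • t)
    (F : (Fin n → T) →+ (Fin n → T)) (hF : ∀ g ∈ D, ∀ w : Fin n → T, F (g • w) = g • F w) :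
    ∃ A : Matrix (Fin n) (Fin n) R, ∀ w i, F w i = ∑ j, A i j • w j := by
  classical
  have key : ∀ i j : Fin n, ∃ c : R, ∀ t : T, F (Pi.single j t) i = c • t := by
    intro i j
    refine hSchur ((Pi.evalAddMonoidHom (fun _ : Fin n => T) i).comp (F.comp (AddMonoidHom.single (fun _ : Fin n => T) j))) ?_
    intro g hg t
    show F (Pi.single j (g • t)) i = g • F (Pi.single j t) i
    rw [Pi.single_smul, hF g hg, Pi.smul_apply]
  choose A hA using key
  refine ⟨Matrix.of A, fun w i => ?_⟩
  conv_lhs => rw [← Finset.univ_sum_single w]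
  rw [map_sum, Finset.sum_apply]
  exact Finset.sum_congr rfl fun j _ => by rw [Matrix.of_apply, hA]

/-- Uniqueness of the matrix when `T` is a FAITHFUL `R`-module. [cite: Lang1990, Ch. 5 §1] -/
theorem matrix_eq_of_faithful (hfaith : ∀ c : R, (∀ t : T, c • t = 0) → c = 0) {n : ℕ} (A B : Matrix (Fin n) (Fin n) R)
    (h : ∀ (w : Fin n → T) (i : Fin n), ∑ j, A i j • w j = ∑ j, B i j • w j) : A = B := by
  classical
  ext i j
  rw [← sub_eq_zero]
  refine hfaith _ fun t => ?_
  have h1 := h (Pi.single j t) i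
  simp only [Pi.single_apply, smul_ite, smul_zero, Finset.sum_ite_eq', Finset.mem_univ, if_true] at h1
  rw [sub_smul, h1, sub_self]

variable {𝒪 : Type*} [Ring 𝒪] {M : Type*} [AddCommGroup M] [Module 𝒪 M] [DistribMulAction G M]

omit [Module R T] in
/-- `Θ⁻¹` is equivariant when `Θ` is. [cite: Kato2004Asterisque, §13.8 (p. 228)] -/
theorem symm_smul {n : ℕ} (Θ : M ≃+ (Fin n → T)) (g : G) (hΘ : ∀ m : M, Θ (g • m) = g • Θ m) (w : Fin n → T) :
    Θ.symm (g • w) = g • Θ.symm w :=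
  Θ.injective (by rw [hΘ, AddEquiv.apply_symm_apply, AddEquiv.apply_symm_apply])

/-- **Schur ⟹ ring hom (H9's algebraic core).** For an equivariant additive `Θ : M ≃+ Tⁿ`, an `𝒪`-module structure on `M` commuting with `G`, `End_G(T) = R`
and `T` faithful over `R`: the transported action is a ring hom `A : 𝒪 →+* Mₙ(R)` with `Θ (a • m) i = ∑ j, A a i j • Θ m j`. [cite: Serre1972, Prop. 12] -/
theorem exists_ringHom_of_equivariant {n : ℕ} (D : Set G)
    (hSchur : ∀ f : T →+ T, (∀ g ∈ D, ∀ t : T, f (g • t) = g • f t) → ∃ c : R, ∀ t, f t = c • t)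
    (hfaith : ∀ c : R, (∀ t : T, c • t = 0) → c = 0)
    (Θ : M ≃+ (Fin n → T)) (hΘ : ∀ g ∈ D, ∀ m : M, Θ (g • m) = g • Θ m)
    (hcomm : ∀ g ∈ D, ∀ (a : 𝒪) (m : M), g • (a • m) = a • (g • m)) :
    ∃ A : 𝒪 →+* Matrix (Fin n) (Fin n) R, ∀ (a : 𝒪) (m : M) (i : Fin n), Θ (a • m) i = ∑ j, A a i j • Θ m j := by
  classical
  -- the conjugate `Θ ∘ (a • ·) ∘ Θ⁻¹` of the `𝒪`-action, as an additive endomorphism of `Tⁿ` (the sketch's `conjAct`, built locally)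
  let conjAct : 𝒪 → ((Fin n → T) →+ (Fin n → T)) := fun a ↦
    Θ.toAddMonoidHom.comp ((DistribSMul.toAddMonoidHom M a).comp Θ.symm.toAddMonoidHom)
  have conjAct_apply : ∀ (a : 𝒪) (w : Fin n → T), conjAct a w = Θ (a • Θ.symm w) := fun _ _ ↦ rfl
  have hequiv : ∀ a : 𝒪, ∀ g ∈ D, ∀ w : Fin n → T, conjAct a (g • w) = g • conjAct a w := by
    intro a g hg w
    rw [conjAct_apply, conjAct_apply, symm_smul Θ g (hΘ g hg), ← hcomm g hg, hΘ g hg]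
  choose A₀ hA₀ using fun a : 𝒪 => exists_matrix_of_equivariant (R := R) D hSchur (conjAct a) (hequiv a)
  -- `hA₀ a : ∀ w i, conjAct a w i = ∑ j, A₀ a i j • w j`
  have hact : ∀ (a : 𝒪) (m : M) (i : Fin n), Θ (a • m) i = ∑ j, A₀ a i j • Θ m j := by
    intro a m i
    rw [← hA₀ a (Θ m) i, conjAct_apply, AddEquiv.symm_apply_apply]
  refine ⟨{ toFun := A₀, map_one' := ?_, map_mul' := ?_, map_zero' := ?_, map_add' := ?_ }, hact⟩
  · refine matrix_eq_of_faithful hfaith _ _ fun w i => ?_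
    rw [← hA₀ 1 w i, conjAct_apply, one_smul, AddEquiv.apply_symm_apply]
    simp only [Matrix.one_apply, ite_smul, one_smul, zero_smul, Finset.sum_ite_eq, Finset.mem_univ, if_true]
  · intro a b
    refine matrix_eq_of_faithful hfaith _ _ fun w i => ?_
    rw [← hA₀ (a * b) w i, conjAct_apply, mul_smul, ← sum_smul_sum_smul]
    rw [hact a, Finset.sum_congr rfl fun j _ => by rw [hact b]]
    simp only [AddEquiv.apply_symm_apply]
  · refine matrix_eq_of_faithful hfaith _ _ fun w i => ?_
    rw [← hA₀ 0 w i, conjAct_apply, zero_smul, map_zero, Pi.zero_apply]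
    simp only [Matrix.zero_apply, zero_smul, Finset.sum_const_zero]
  · intro a b
    refine matrix_eq_of_faithful hfaith _ _ fun w i => ?_
    rw [← hA₀ (a + b) w i, conjAct_apply, add_smul, map_add, Pi.add_apply, hact a, hact b]
    simp only [AddEquiv.apply_symm_apply, Matrix.add_apply, add_smul, Finset.sum_add_distrib]

end SchurMatrix

/-! ## §2 THE TRIVIALISATION `e : (Fin n → R⟦X⟧) ≃+ 𝒪⟦X⟧`, coefficientwise from `Φ : 𝒪 ≃+ Rⁿ` (the sketch's `triv Φ`, here through its
## coefficient formula `he : ∀ t m, coeff m (e t) = Φ⁻¹ ((coeff m (t i))_i)`, so that no definition is introduced) -/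

section Triv

variable {R : Type*} [CommRing R] {𝒪 : Type*} [CommRing 𝒪] {n : ℕ}

/-- **The trivialisation exists (H10 (b)).** Coefficientwise transport along an additive `Φ : 𝒪 ≃+ Rⁿ`: an additive equivalence
`e : (Fin n → R⟦X⟧) ≃+ 𝒪⟦X⟧` with `(e t)_m = Φ⁻¹ ((t i)_m)_i`. [cite: Washington1997, §7.1] -/
theorem exists_coeffwise_addEquiv (Φ : 𝒪 ≃+ (Fin n → R)) :
    ∃ e : (Fin n → PowerSeries R) ≃+ PowerSeries 𝒪,
      ∀ (t : Fin n → PowerSeries R) (m : ℕ), PowerSeries.coeff m (e t) = Φ.symm fun i => PowerSeries.coeff m (t i) :=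
  ⟨{ toFun := fun t => PowerSeries.mk fun m => Φ.symm fun i => PowerSeries.coeff m (t i)
     invFun := fun s => fun i => PowerSeries.mk fun m => Φ (PowerSeries.coeff m s) i
     left_inv := fun t => by
       funext i
       ext m
       simp only [PowerSeries.coeff_mk, AddEquiv.apply_symm_apply]
     right_inv := fun s => by
       ext m
       simp only [PowerSeries.coeff_mk, AddEquiv.symm_apply_apply]
     map_add' := fun t t' => by
       ext m
       simp only [PowerSeries.coeff_mk, Pi.add_apply, map_add]
       rw [← map_add]
       rfl },
    fun t m => by simp only [AddEquiv.coe_mk, Equiv.coe_fn_mk, PowerSeries.coeff_mk]⟩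

/-- `Φ⁻¹ (c • v) = ι c * Φ⁻¹ v` from `Φ (ι c * b) = c • Φ b`. [cite: Washington1997, §7.1] -/
theorem symm_smul_eq (ι : R →+* 𝒪) (Φ : 𝒪 ≃+ (Fin n → R)) (hΦι : ∀ (c : R) (b : 𝒪), Φ (ι c * b) = c • Φ b)
    (c : R) (v : Fin n → R) : Φ.symm (c • v) = ι c * Φ.symm v :=
  Φ.injective (by rw [hΦι, AddEquiv.apply_symm_apply, AddEquiv.apply_symm_apply])

variable (Φ : 𝒪 ≃+ (Fin n → R)) (e : (Fin n → PowerSeries R) ≃+ PowerSeries 𝒪)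
  (he : ∀ (t : Fin n → PowerSeries R) (m : ℕ), PowerSeries.coeff m (e t) = Φ.symm fun i => PowerSeries.coeff m (t i))
include he

/-- **The coefficientwise `e` is `Λ`-semilinear**: `e (r • t) = (map ι r) * e t` for every `r ∈ R⟦X⟧` — the instance-free form of `R⟦X⟧`-linearity
w.r.t. `(PowerSeries.map ι).toAlgebra`. [cite: Washington1997, §7.1, §13.2] -/
theorem coeffwise_smul (ι : R →+* 𝒪) (hΦι : ∀ (c : R) (b : 𝒪), Φ (ι c * b) = c • Φ b)
    (r : PowerSeries R) (t : Fin n → PowerSeries R) :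
    e (r • t) = PowerSeries.map ι r * e t := by
  ext m
  rw [he, PowerSeries.coeff_mul]
  have hcoeff : (fun i => PowerSeries.coeff m ((r • t) i)) =
      ∑ q ∈ Finset.HasAntidiagonal.antidiagonal m, PowerSeries.coeff q.1 r • fun i => PowerSeries.coeff q.2 (t i) := by
    funext i
    rw [Pi.smul_apply, smul_eq_mul, PowerSeries.coeff_mul, Finset.sum_apply]
    exact Finset.sum_congr rfl fun q _ => by rw [Pi.smul_apply, smul_eq_mul]
  rw [hcoeff, map_sum]
  exact Finset.sum_congr rfl fun q _ => by rw [symm_smul_eq ι Φ hΦι, PowerSeries.coeff_map, he]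

/-- LIN-X at the target: `e (X • t) = X * e t` (no hypothesis on `Φ`). [cite: Washington1997, §13.2] -/
theorem coeffwise_X_smul (t : Fin n → PowerSeries R) :
    e ((PowerSeries.X : PowerSeries R) • t) = (PowerSeries.X : PowerSeries 𝒪) * e t := by
  ext m
  rw [he]
  cases m with
  | zero =>
      simp only [Pi.smul_apply, smul_eq_mul, PowerSeries.coeff_zero_X_mul]
      exact map_zero Φ.symm
  | succ m =>
      simp only [Pi.smul_apply, smul_eq_mul, PowerSeries.coeff_succ_X_mul, he]

/-- The coefficientwise action of a constant matrix `N ∈ Mₙ(R)` on `(R⟦X⟧)ⁿ`, `(N ⋆ t) i = ∑ j, C (N i j) * t j` (written inline), is carried by `e`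
to multiplication by `C a` when `Φ (a * b) = (A a).mulVec (Φ b)` — H9's VALUE form meets H10. [cite: Kato2004Asterisque, §13.8 (p. 228)] -/
theorem coeffwise_matrixSMul (A : 𝒪 →+* Matrix (Fin n) (Fin n) R)
    (hΦA : ∀ a b : 𝒪, Φ (a * b) = (A a).mulVec (Φ b)) (a : 𝒪) (t : Fin n → PowerSeries R) :
    e (fun i => ∑ j, (PowerSeries.C (A a i j) : PowerSeries R) * t j) = (PowerSeries.C a : PowerSeries 𝒪) * e t := by
  ext m
  rw [he, PowerSeries.coeff_C_mul, he]
  have hsymm : ∀ v : Fin n → R, Φ.symm ((A a).mulVec v) = a * Φ.symm v := fun v =>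
    Φ.injective (by rw [hΦA, AddEquiv.apply_symm_apply, AddEquiv.apply_symm_apply])
  rw [← hsymm]
  congr 1
  funext i
  rw [map_sum, Matrix.mulVec, dotProduct]
  exact Finset.sum_congr rfl fun j _ => by rw [PowerSeries.coeff_C_mul]

end Triv

/-! ## §3 H10 FROM ITS PARTS: LIN-X + LIN-𝒪 on a `Λ_𝒪`-submodule + LATTICE ⟹ full `Λ_𝒪`-semilinearity of `e ∘ 𝒸` there -/

section Semilinear

variable {R : Type*} [CommRing R] {𝒪 : Type*} [CommRing 𝒪] {n : ℕ}
  {H : Type*} [AddCommGroup H] [Module (PowerSeries 𝒪) H]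

/-- `𝒪⟦X⟧` is `X`-adically separated. [cite: Lang1990, Ch. 5 §1 (p. 94)] -/
theorem powerSeries_eq_zero_of_forall_X_pow (v : PowerSeries 𝒪)
    (h : ∀ N : ℕ, ∃ w : PowerSeries 𝒪, v = (PowerSeries.X : PowerSeries 𝒪) ^ N • w) : v = 0 := by
  ext m
  obtain ⟨w, hw⟩ := h (m + 1)
  rw [hw, smul_eq_mul, PowerSeries.coeff_X_pow_mul', if_neg (by omega), map_zero]

/-- **H10 on a submodule from LIN-X, LIN-𝒪 and the lattice.** If on the `Λ_𝒪`-submodule `S` the coordinates satisfy the single `X`-step and the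
`𝒪`-CONSTANT step through the matrices `A a` (H9's value form), and `Φ` is `A`-equivariant with coefficientwise `e` (§2), then `e (𝒸 (s • x)) = s * e (𝒸 x)`
for EVERY `s ∈ 𝒪⟦X⟧`, `x ∈ S` (`ColemanSideInjective.apply_smul_eq_smul_of_X_of_C` at `A := 𝒪`, `V := 𝒪⟦X⟧`). [cite: Washington1997, §13.2] [cite: Lang1990, Ch. 6 §2] -/
theorem semilinear_on_submodule (𝒸 : H →+ (Fin n → PowerSeries R)) (S : Submodule (PowerSeries 𝒪) H)
    (A : 𝒪 →+* Matrix (Fin n) (Fin n) R) (Φ : 𝒪 ≃+ (Fin n → R)) (hΦA : ∀ a b : 𝒪, Φ (a * b) = (A a).mulVec (Φ b))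
    (e : (Fin n → PowerSeries R) ≃+ PowerSeries 𝒪)
    (he : ∀ (t : Fin n → PowerSeries R) (m : ℕ), PowerSeries.coeff m (e t) = Φ.symm fun i => PowerSeries.coeff m (t i))
    (hX : ∀ x ∈ S, 𝒸 ((PowerSeries.X : PowerSeries 𝒪) • x) = (PowerSeries.X : PowerSeries R) • 𝒸 x)
    (hO : ∀ (a : 𝒪), ∀ x ∈ S, 𝒸 ((PowerSeries.C a : PowerSeries 𝒪) • x) = fun i => ∑ j, (PowerSeries.C (A a i j) : PowerSeries R) * 𝒸 x j)
    (s : PowerSeries 𝒪) : ∀ x ∈ S, e (𝒸 (s • x)) = s * e (𝒸 x) := by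
  intro x hx
  have key := Theorems.ColemanSideInjective.apply_smul_eq_smul_of_X_of_C (A := 𝒪) (ΛO := PowerSeries 𝒪) (V := PowerSeries 𝒪)
    powerSeries_eq_zero_of_forall_X_pow (RingHom.id (PowerSeries 𝒪)) (e.toAddMonoidHom.comp 𝒸) S
    (fun y hy => by
      rw [RingHom.id_apply, AddMonoidHom.comp_apply, AddMonoidHom.comp_apply, AddEquiv.coe_toAddMonoidHom, hX y hy,
        coeffwise_X_smul Φ e he, smul_eq_mul])
    (fun a y hy => by
      rw [RingHom.id_apply, AddMonoidHom.comp_apply, AddMonoidHom.comp_apply, AddEquiv.coe_toAddMonoidHom, hO a y hy,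
        coeffwise_matrixSMul Φ e he A hΦA, smul_eq_mul])
    s x hx
  simpa only [RingHom.id_apply, AddMonoidHom.comp_apply, AddEquiv.coe_toAddMonoidHom, smul_eq_mul] using key

/-- **H10 = ∃ e.** The `Λ`-semilinear trivialisation with `e (𝒸 (s • x)) = s * e (𝒸 x)` on `S` exists as soon as LIN-X, LIN-𝒪 (H9, value form) and the
LATTICE `Φ` (§5) are supplied. [cite: Washington1997, §13.2, §7.1] [cite: Kato2004Asterisque, Thm. 12.5 (1) (p. 221)] -/
theorem exists_trivialisation (ι : R →+* 𝒪) (𝒸 : H →+ (Fin n → PowerSeries R)) (S : Submodule (PowerSeries 𝒪) H)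
    (A : 𝒪 →+* Matrix (Fin n) (Fin n) R) (Φ : 𝒪 ≃+ (Fin n → R)) (hΦA : ∀ a b : 𝒪, Φ (a * b) = (A a).mulVec (Φ b))
    (hΦι : ∀ (c : R) (b : 𝒪), Φ (ι c * b) = c • Φ b)
    (hX : ∀ x ∈ S, 𝒸 ((PowerSeries.X : PowerSeries 𝒪) • x) = (PowerSeries.X : PowerSeries R) • 𝒸 x)
    (hO : ∀ (a : 𝒪), ∀ x ∈ S, 𝒸 ((PowerSeries.C a : PowerSeries 𝒪) • x) = fun i => ∑ j, (PowerSeries.C (A a i j) : PowerSeries R) * 𝒸 x j) :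
    ∃ e : (Fin n → PowerSeries R) ≃+ PowerSeries 𝒪,
      (∀ (r : PowerSeries R) (t : Fin n → PowerSeries R), e (r • t) = PowerSeries.map ι r * e t) ∧
      ∀ (s : PowerSeries 𝒪), ∀ x ∈ S, e (𝒸 (s • x)) = s * e (𝒸 x) := by
  obtain ⟨e, he⟩ := exists_coeffwise_addEquiv (R := R) Φ
  exact ⟨e, coeffwise_smul Φ e he ι hΦι, semilinear_on_submodule 𝒸 S A Φ hΦA e he hX hO⟩

/-! ## §4 GLUE to k2-g18 PLAN 1: H10 on `Λ_𝒪 z` + H11 ⟹ the column identity `he` -/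

/-- **`he` of k2-g18's `colQuotEquiv` from its two parts (PROVED).** H10 on `S = Λ_𝒪·z` and the ERL value identity H11 `e (𝒸 z) = D * (Lm * u)` give
`e (𝒸 (r • z)) = r * (D * (Lm * u))` for every `r ∈ Λ_𝒪`. [cite: Kato2004Asterisque, Thm. 12.5 (1) (p. 221)] -/
theorem he_of_parts (𝒸 : H →+ (Fin n → PowerSeries R)) (z : H) (e : (Fin n → PowerSeries R) ≃+ PowerSeries 𝒪)
    (htriv : ∀ (s : PowerSeries 𝒪), ∀ x ∈ Submodule.span (PowerSeries 𝒪) ({z} : Set H), e (𝒸 (s • x)) = s * e (𝒸 x))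
    (D Lm u : PowerSeries 𝒪) (hval : e (𝒸 z) = D * (Lm * u)) (r : PowerSeries 𝒪) :
    e (𝒸 (r • z)) = r * (D * (Lm * u)) := by
  rw [htriv r z (Submodule.mem_span_singleton_self z), hval]

/-- **The PRICE node, decomposed (PROVED glue, end to end).** LIN-X + LIN-𝒪 on `Λ_𝒪·z` + LATTICE + H11 (for the produced `e`) ⟹ k2-g18's input
`⟨e, u, hu, he⟩` with `e` `Λ`-semilinear. [cite: Kato2004Asterisque, Thm. 12.5 (1) (p. 221)] [cite: Washington1997, §13.2] -/
theorem price_of_parts (ι : R →+* 𝒪) (𝒸 : H →+ (Fin n → PowerSeries R)) (z : H)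
    (A : 𝒪 →+* Matrix (Fin n) (Fin n) R) (Φ : 𝒪 ≃+ (Fin n → R)) (hΦA : ∀ a b : 𝒪, Φ (a * b) = (A a).mulVec (Φ b))
    (hΦι : ∀ (c : R) (b : 𝒪), Φ (ι c * b) = c • Φ b)
    (hX : ∀ x ∈ Submodule.span (PowerSeries 𝒪) ({z} : Set H),
      𝒸 ((PowerSeries.X : PowerSeries 𝒪) • x) = (PowerSeries.X : PowerSeries R) • 𝒸 x)
    (hO : ∀ (a : 𝒪), ∀ x ∈ Submodule.span (PowerSeries 𝒪) ({z} : Set H),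
      𝒸 ((PowerSeries.C a : PowerSeries 𝒪) • x) = fun i => ∑ j, (PowerSeries.C (A a i j) : PowerSeries R) * 𝒸 x j)
    (D Lm : PowerSeries 𝒪)
    (hERL : ∀ e : (Fin n → PowerSeries R) ≃+ PowerSeries 𝒪,
      (∀ (r : PowerSeries R) (t : Fin n → PowerSeries R), e (r • t) = PowerSeries.map ι r * e t) →
      (∀ (a : 𝒪) (t : Fin n → PowerSeries R), e (fun i => ∑ j, (PowerSeries.C (A a i j) : PowerSeries R) * t j) = (PowerSeries.C a : PowerSeries 𝒪) * e t) →
      ∃ u : PowerSeries 𝒪, u ≠ 0 ∧ e (𝒸 z) = D * (Lm * u)) :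
    ∃ (e : (Fin n → PowerSeries R) ≃+ PowerSeries 𝒪) (u : PowerSeries 𝒪), u ≠ 0 ∧
      (∀ (r : PowerSeries R) (t : Fin n → PowerSeries R), e (r • t) = PowerSeries.map ι r * e t) ∧
      ∀ r : PowerSeries 𝒪, e (𝒸 (r • z)) = r * (D * (Lm * u)) := by
  obtain ⟨e, he⟩ := exists_coeffwise_addEquiv (R := R) Φ
  obtain ⟨u, hu, hval⟩ := hERL e (coeffwise_smul Φ e he ι hΦι) (coeffwise_matrixSMul Φ e he A hΦA)
  exact ⟨e, u, hu, coeffwise_smul Φ e he ι hΦι,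
    he_of_parts 𝒸 z e (semilinear_on_submodule 𝒸 _ A Φ hΦA e he hX hO) D Lm u hval⟩

end Semilinear

/-! ## §5 LATTICE (H10 (a)): a torsion-free `𝒪`-structure on `Rⁿ` through `A : 𝒪 →+* Mₙ(R)` is free of rank one when `𝒪` is a PID of `R`-rank `n` -/

section Lattice

variable {R : Type*} [CommRing R] [Nontrivial R] {𝒪 : Type*} [CommRing 𝒪] [IsDomain 𝒪] [IsPrincipalIdealRing 𝒪] {n : ℕ}

/-- **LATTICE (H10 (a)).** `ι : R →+* 𝒪` makes `𝒪` additively `Rⁿ` (`B`, `hB`), `𝒪` a PID, `A : 𝒪 →+* Mₙ(R)` with `A (ι c) = c • 1` and no zero-divisors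
on vectors ⟹ an additive `Φ : 𝒪 ≃+ Rⁿ` with `Φ (a * b) = A a *ᵥ Φ b` (hence `Φ (ι c * b) = c • Φ b`): structure theorem over a PID + rank count `n · rk_𝒪 = n`
(at RTT: `R = ℤ₂`, `𝒪 = 𝒪_S`, `n = f`, `A` = §1's transport through `Θ`). [cite: Lang1990, Ch. 5 §1] [cite: Washington1997, §13.2] -/
theorem exists_equivariant_addEquiv (ι : R →+* 𝒪) (hn0 : 0 < n) (B : 𝒪 ≃+ (Fin n → R)) (hB : ∀ (c : R) (b : 𝒪), B (ι c * b) = c • B b)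
    (A : 𝒪 →+* Matrix (Fin n) (Fin n) R) (hAι : ∀ c : R, A (ι c) = c • (1 : Matrix (Fin n) (Fin n) R))
    (htf : ∀ (a : 𝒪) (v : Fin n → R), (A a).mulVec v = 0 → a = 0 ∨ v = 0) :
    ∃ Φ : 𝒪 ≃+ (Fin n → R), (∀ a b : 𝒪, Φ (a * b) = (A a).mulVec (Φ b)) ∧ ∀ (c : R) (b : 𝒪), Φ (ι c * b) = c • Φ b := by
  classical
  -- (0) the second clause follows from the first
  suffices h : ∃ Φ : 𝒪 ≃+ (Fin n → R), ∀ a b : 𝒪, Φ (a * b) = (A a).mulVec (Φ b) by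
    obtain ⟨Φ, hΦ⟩ := h
    exact ⟨Φ, hΦ, fun c b => by rw [hΦ, hAι, Matrix.smul_mulVec, Matrix.one_mulVec]⟩
  -- (1) `R`-algebra structure on `𝒪` through `ι`; `𝒪` is free of rank `n` over `R` through `B`
  letI : Algebra R 𝒪 := ι.toAlgebra
  have hι : ∀ c : R, algebraMap R 𝒪 c = ι c := fun _ => rfl
  let L : 𝒪 ≃ₗ[R] (Fin n → R) :=
    { B with map_smul' := fun c b => by rw [Algebra.smul_def, hι]; exact hB c b }
  haveI : Module.Free R 𝒪 := Module.Free.of_equiv L.symm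
  haveI : Module.Finite R 𝒪 := Module.Finite.equiv L.symm
  have hrk : Module.finrank R 𝒪 = n := by rw [L.finrank_eq, Module.finrank_fin_fun]
  -- (2) the `𝒪`-module structure on `Rⁿ` through `A` (the action ring hom `𝒪 →+* End_R(Rⁿ)`, the sketch's `actHom`, built locally)
  let actHom : 𝒪 →+* Module.End R (Fin n → R) :=
    { toFun := fun a => Matrix.toLin' (A a)
      map_one' := by rw [map_one, Matrix.toLin'_one]; rfl
      map_mul' := fun a b => by rw [map_mul, Matrix.toLin'_mul]; rfl
      map_zero' := by rw [map_zero, map_zero]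
      map_add' := fun a b => by rw [map_add, map_add] }
  letI instA : Module 𝒪 (Fin n → R) := Module.compHom (Fin n → R) actHom
  have hsmul : ∀ (a : 𝒪) (v : Fin n → R), a • v = (A a).mulVec v := fun a v => Matrix.toLin'_apply (A a) v
  haveI : IsScalarTower R 𝒪 (Fin n → R) := ⟨fun c a v => by
    rw [hsmul, hsmul, Algebra.smul_def, hι, map_mul, hAι, smul_mul_assoc, one_mul, Matrix.smul_mulVec]⟩
  haveI : Module.Finite 𝒪 (Fin n → R) := Module.Finite.of_restrictScalars_finite R 𝒪 (Fin n → R)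
  haveI : NoZeroSMulDivisors 𝒪 (Fin n → R) := ⟨fun {a v} h => htf a v (by rwa [← hsmul])⟩
  haveI : Module.Free 𝒪 (Fin n → R) := Module.free_of_finite_type_torsion_free'
  -- (3) rank count: `n * rk_𝒪 (Rⁿ) = n`
  have hmul := Module.finrank_mul_finrank R 𝒪 (Fin n → R)
  rw [hrk, Module.finrank_fin_fun] at hmul
  have h1 : Module.finrank 𝒪 (Fin n → R) = 1 := Nat.eq_of_mul_eq_mul_left hn0 (by rw [hmul, mul_one])
  -- (4) a basis of cardinality one
  let b := Module.finBasisOfFinrankEq 𝒪 (Fin n → R) h1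
  let E : (Fin n → R) ≃ₗ[𝒪] 𝒪 := b.equivFun.trans (LinearEquiv.funUnique (Fin 1) 𝒪 𝒪)
  refine ⟨E.symm.toAddEquiv, fun a b' => ?_⟩
  show E.symm (a * b') = (A a).mulVec (E.symm b')
  rw [← smul_eq_mul, LinearEquiv.map_smul, hsmul]

omit [Nontrivial R] [IsDomain 𝒪] [IsPrincipalIdealRing 𝒪] in
/-- **Torsion-freeness is automatic (the `htf` input of `exists_equivariant_addEquiv`).** If every `a ≠ 0` in `𝒪` divides a nonzero CONSTANT
(`a * a' = ι c`, `c ≠ 0` — the norm: `𝒪_S` is an order over `ℤ₂`) and `R` is a domain, then `A a *ᵥ v = 0 ⟹ a = 0 ∨ v = 0`.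
(k2-g19 records the same remark via `Algebra.IsAlgebraic`; this is the instance-free form.) [cite: Lang1990, Ch. 5 §1] -/
theorem htf_of_norm [IsDomain R] (ι : R →+* 𝒪) (A : 𝒪 →+* Matrix (Fin n) (Fin n) R)
    (hAι : ∀ c : R, A (ι c) = c • (1 : Matrix (Fin n) (Fin n) R))
    (hnorm : ∀ a : 𝒪, a ≠ 0 → ∃ (a' : 𝒪) (c : R), c ≠ 0 ∧ a' * a = ι c)
    (a : 𝒪) (v : Fin n → R) (hv : (A a).mulVec v = 0) : a = 0 ∨ v = 0 := by
  classical
  by_cases ha : a = 0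
  · exact Or.inl ha
  · refine Or.inr ?_
    obtain ⟨a', c, hc, h⟩ := hnorm a ha
    have h1 : (A (a' * a)).mulVec v = 0 := by rw [map_mul, ← Matrix.mulVec_mulVec, hv, Matrix.mulVec_zero]
    rw [h, hAι, Matrix.smul_mulVec, Matrix.one_mulVec] at h1
    exact (smul_eq_zero.mp h1).resolve_left hc

end Lattice

/-! ## §6 Rank bookkeeping `n = f` from `2`-torsion counts through `Θ` -/

section Count

variable {T : Type*} [AddCommGroup T] {M : Type*} [AddCommGroup M] {n : ℕ}

/-- `Θ : M ≃+ Tⁿ` restricts to `M[2] ≃ (T[2])ⁿ` (the sketch's `twoTorsionEquiv`, kept as an existence statement so that no definition is introduced).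
[cite: Serre1972, Prop. 12] -/
theorem nonempty_twoTorsion_equiv (Θ : M ≃+ (Fin n → T)) : Nonempty ({m : M // 2 • m = 0} ≃ (Fin n → {t : T // 2 • t = 0})) :=
  ⟨{ toFun := fun m => fun i => ⟨Θ m.1 i, by rw [← Pi.smul_apply, ← map_nsmul, m.2, map_zero, Pi.zero_apply]⟩
     invFun := fun w => ⟨Θ.symm fun i => (w i).1, by
       rw [← map_nsmul]
       have : (2 : ℕ) • (fun i => ((w i).1 : T)) = 0 := funext fun i => by rw [Pi.smul_apply, (w i).2, Pi.zero_apply]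
       rw [this, map_zero]⟩
     left_inv := fun m => by
       apply Subtype.ext
       simp only [AddEquiv.symm_apply_apply]
     right_inv := fun w => by
       funext i
       apply Subtype.ext
       simp only [AddEquiv.apply_symm_apply] }⟩

/-- **`n = f` (PROVED).** If `#T[2] = q > 1` and `#M[2] = qᶠ`, an additive `Θ : M ≃+ Tⁿ` forces `n = f` (at RTT: `q = 4`, `M = (K_S/𝒪_S)²`,
`T = W[2^∞]`, so the RSL_g binder `n` IS `f = [𝒪_S : ℤ₂]`). [cite: Serre1972, Prop. 12] -/
theorem n_eq_of_card_two_torsion (Θ : M ≃+ (Fin n → T)) {q f : ℕ} (hq : 1 < q)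
    (hT : Nat.card {t : T // 2 • t = 0} = q) (hM : Nat.card {m : M // 2 • m = 0} = q ^ f) : n = f := by
  haveI : Finite {t : T // 2 • t = 0} := Nat.finite_of_card_ne_zero (by rw [hT]; omega)
  obtain ⟨eT⟩ := nonempty_twoTorsion_equiv Θ
  have hcard := Nat.card_congr eT
  rw [hM, Nat.card_fun, hT, Nat.card_eq_fintype_card, Fintype.card_fin] at hcard
  exact (Nat.pow_right_injective hq hcard).symm

end Count

end Summit.BirchSwinnertonDyer.BirchSwinnertonDyer.Theorems.ThetaTransport.PriceNode

end
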